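import Summits.BirchSwinnertonDyer.BirchSwinnertonDyer.Theorems.SchneiderFreeSocketsV2
import Summits.BirchSwinnertonDyer.Rank1Residual.Additive.UnramifiedBaseChange
import Literature.NumberTheory.EllipticCurves.KrizLi2019.EisensteinHeegnerLog
import HarnessLib

/-!
# Route `SchneiderFreeAdditiveX3` — the KRIZ–LI SUB-LOCUS of the door's data: where the T-B6-1♯ socket
# of the branch cruxes `PotMultBranchIMC` (item 19176) / `GordTwoBranchIMC` (item 19177) is a consequence
# of a PUBLISHED theorem already in the tree, with NO main conjecture and NO BDP `p`-adic `L`-function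

Cell `bsd-schneider-ideate`, seat `bsd-schneider-door-c2` (prover, gen 7), `--supports
stmt-BirchSwinnertonDyer-19176 --as helper`. HONEST FRAMING: BSD is not advanced; both branch cruxes stay
OPEN (they quantify over ALL Heegner data of the socket, and Kriz–Li's Bernoulli hypothesis (4) depends
on the Heegner field `K`); nothing here is a Literature fact; the one named fact consumed —
`Literature.NumberTheory.EllipticCurves.KrizLi2019.thm120_padicLogHeegner_unit_of_bernoulli`
(Kriz–Li, Forum Math. Sigma 7 (2019) e15, Thm. 1.20 = Thm. 7.1, PUBLISHED, refereed; "Our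
generalization, in particular, does not require `p ∤ N`", p. 42) — enters BY NAME as an explicit
hypothesis `hKL`, exactly as the X12/O11 (bsd-cm, Route U) and X7 consumers of the same fact take it.

## What is proved (imports are Theses-free: sockets v2 + Literature, director-bsd 2026-08-26T19:10Z rule)

The door's socket at a frame is (SocketsV2, `AdditiveIMCLowerBDPOnTreeLeAt p κ 𝔭 γ ι s P`):
`∃ n, HasCharValuationAt(X_ac^∅) n ∧ 2·ord_p log_{ω_E} P ≤ n + 2s`, read at the Manin slack
`s = v_p(Dt.c)`. Door-c2 g2 (`…PotMultBranchIMCReceptacle`, p421158) isolated the CONTENT-FREE REGIME: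
at a frame with `ord_p log_{ω_E} P ≤ s` the inequality holds for every `n`, so the socket is just CTL₀
(`∃ n, HasCharValuationAt … n`, itself a theorem of the tree from Poitou–Tate duality + Kolyvagin:
door-c4 g4, `…ControlLeMinimal.exists_hasCharValuationAt_of_pt_of_kolyvagin`, p448348). This file
DISCHARGES the regime's hypothesis from print:

* §1 `padicLogOrd_le_padicValInt_of_krizLi` — Kriz–Li's printed conclusion
  `(|Ẽ^{ns}(𝔽_p)|/p) · log_{ω_E} P / c ≢ 0 (mod p)` (tree reading: `¬ ‖·‖_p ≤ p⁻¹`) together with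
  `|Ẽ^{ns}(𝔽_p)| = p` gives `log_{ω_E} P ≠ 0`, `c ≠ 0` and **`ord_p log_{ω_E} P ≤ ord_p c`** (no
  integrality / Rem. 3.10 needed for this direction); `nsPointCount_eq_self_of_addv`: `|Ẽ^{ns}(𝔽_p)| = p`
  at an ADDITIVE prime (`a_p = 0`, Kriz–Li Rem. 1.17; the tree's
  `LFunction_apply_eq_zero_of_hasAdditiveReductionAt`) — every prime of the door's cells (X3) is additive.
* §2 `additiveIMCLowerBDPOnTreeLeAt_of_charTorsion_of_krizLi` — CTL₀ at a frame + the Kriz–Li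
  conclusion at the datum ⟹ the socket at slack `v_p(c)` (door-c2 g2's regime, re-proved in three
  lines to keep this module out of the route file's import cone).
* §3 `additiveIMCLowerBDPOnTreeLeAt_of_thm120` — **the door-datum theorem**: the named fact `hKL` BY
  NAME, a door datum `(W, p; N, K, Dt, H, ι, P)` on the N10 locus (additive `p`, Heegner hypothesis for
  `N = N_W`, `K` imaginary quadratic — so `p` SPLITS in `K`), Kriz–Li's curve-level binders (a primitive
  `ψ` of conductor `f` and the Teichmüller `ω` with `E[p]^{ss} ≅ 𝔽_p(ψ) ⊕ 𝔽_p(ψ⁻¹ω)` in trace form,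
  (1) `ψ(p) ≠ 1 ≠ (ψ⁻¹ω)(p)`, (2) no split multiplicative prime, (3) the additive-prime condition) and
  `K`-level binders (the Kronecker character `ε_K`, (4) `B_{1,ψ₀⁻¹ε_K}·B_{1,ψ₀ω⁻¹} ≢ 0 (mod p)`), an
  anticyclotomic frame `(κ, γ, 𝔭)` with `𝔭 ∣ p` of degree one, and CTL₀ at that frame ⟹
  `AdditiveIMCLowerBDPOnTreeLeAt p κ 𝔭 γ (embAt K p 𝔭) (v_p Dt.c) P` — VERBATIM the conclusion of the
  socket `AdditiveIMCLowerBDPInputManinAt W p` at that datum and frame, i.e. what `PotMultBranchIMC` /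
  `GordTwoBranchIMC` assert there. Kriz–Li is read at the embedding `ιp := embAt K p 𝔭` of the frame.
* §4 `additiveIMCLowerBDP_krizLiData_of_thm120_of_charTorsion` — the same over ALL door data and frames,
  with CTL₀ supplied in EXACTLY the shape of door-c4 g4's
  `exists_hasCharValuationAt_of_pt_of_kolyvagin hPT hKo` (so the by-facts form «{Poitou–Tate duality,
  Kolyvagin, Kriz–Li Thm. 1.20} ⟹ T-B6-1♯ at every Kriz–Li datum of the door» is the one-liner
  `additiveIMCLowerBDP_krizLiData_of_thm120_of_charTorsion hKL (exists_hasCharValuationAt_of_pt_of_kolyvagin hPT hKo)`,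
  kernel-checked in the seat folder; not filed here to keep this module Theses-free).

READING. On the Kriz–Li locus the Heegner point is `p`-adically PRIMITIVE up to the parametrisation
constant (`ord_p log_{ω_E} P ≤ v_p(c)`), so the door direction «𝓛^{BDP} ∣ char» ∘ «BDP value at 𝟙»
has nothing to prove: `2·ord_p log_{ω_E} P ≤ 2·v_p(c) ≤ ord_p f_ac(0) + 2·v_p(c)`. The research content
of the two branch cruxes (H3|M unwritten; H3|G = Keller–Yin 2410.23241 Thm. 3.5.1, PRE) is therefore
concentrated on the data with `log_{ω_E} P / c ≡ 0 (mod p)` — the complement of a locus cut out by the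
hypotheses of a published theorem. The Kriz–Li hypotheses do not see the reduction type of `E` at `p`
beyond `a_p = 0`, so the theorem serves the (M) cell (r2) and the (G-ord, `e = 2`) cell (r3) alike
(and the `e ∈ {3,4,6}` X3 pairs outside the door). On the door at `p ≥ 5` hypothesis (1) is automatic
(both characters of `E[p]^{ss}` are ramified at `p`: `{ψ, ψ⁻¹ω}|_{I_p} = {ε, εω}·unr`, `ε = ω^{(p−1)/2}`,
`εω ≠ 1`); at `p = 3` (`ε = ω`) it reads «`E[3]^{ss} = {χ_d, χ_{−3d}}` with `3` inert in `ℚ(√d)`»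
and fails on every class with a rational `3`-torsion member — recorded, not formalised here.

References: [KrizLi2019] D. Kriz, C. Li, *Goldfeld's conjecture and congruences between Heegner
points*, Forum Math. Sigma 7 (2019) e15, Thm. 1.20 (pp. 7–8) = Thm. 7.1 (pp. 42–43), Rem. 1.17 (p. 6);
[JetchevSkinnerWan2017] §7.4.1 (arXiv:1512.06894 p. 30: the inequality with the constant);
[Castella2018] §2.2, Thm. 2.3 (arXiv:1704.06608 p. 5: `log_{ω_E}`, `ord_p f_ac(0)`).
-/

noncomputable section

open scoped Classical

open WeierstrassCurve NumberField IsDedekindDomain Field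
  Literature.NumberTheory.EllipticCurves
  Literature.NumberTheory.EllipticCurves.ModularForms
  Literature.NumberTheory.EllipticCurves.GreenbergSelmer
  Literature.NumberTheory.EllipticCurves.Rank1Residual
  Summit.BirchSwinnertonDyer.Rank1Residual
  Summit.BirchSwinnertonDyer.Rank1Residual.X11b
  Summit.BirchSwinnertonDyer.Rank1Residual.X11b.AcSelmer

-- D-0017 layout: summit = sub-problem, so `Summit.BirchSwinnertonDyer.BirchSwinnertonDyer.…` is the
-- mandated namespace (same option as the route's sockets files).
set_option linter.dupNamespace false
set_option autoImplicit false

namespace Summit.BirchSwinnertonDyer.BirchSwinnertonDyer.Theorems.SchneiderFree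

/-! ## §1 Kriz–Li's conclusion in `ord_p` bookkeeping at an additive prime -/

section Valuation

variable {W : WeierstrassCurve ℚ} [W.IsElliptic] [W.IsGloballyMinimal] {p : ℕ} [Fact p.Prime]

omit [W.IsGloballyMinimal] in
/-- **`|Ẽ^{ns}(𝔽_p)| = p` at an ADDITIVE prime** (Kriz–Li Rem. 1.17: `a_p = 0` and no `+1`), for the
cell's `Addv W p` («neither good nor multiplicative»): `KrizLi2019.nsPointCount W p` unfolds to
`p + [good] − a_p(W)` and `a_p(W) = W.LFunction p = 0` by the tree's
`LFunction_apply_eq_zero_of_hasAdditiveReductionAt`. (bsd-cm's `RouteU.nsPointCount_eq_of_lFunction_eq_zero`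
is the same with `a_p = 0` as a hypothesis.) [cite: KrizLi2019, Rem. 1.17 (p. 6)] -/
theorem nsPointCount_eq_self_of_addv (hadd : Addv W p) : KrizLi2019.nsPointCount W p = p := by
  have ha : W.LFunction p = 0 :=
    W.LFunction_apply_eq_zero_of_hasAdditiveReductionAt (Additive.primesEquiv_symm_apply_coe p)
      (Additive.hasAdditiveReductionAt_of_addv W p hadd) dvd_rfl
  unfold KrizLi2019.nsPointCount
  rw [dif_pos (Fact.out : p.Prime), ha, sub_zero]
  simp [hadd.1]

variable {K : Type} [Field K] [NumberField K] {ιp : K →+* ℚ_[p]} {P : (W.baseChange K).toAffine.Point}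
  {c : ℤ}

/-- **Kriz–Li's printed conclusion ⟹ `ord_p log_{ω_E} P ≤ ord_p c` at an additive prime.** If
`|Ẽ^{ns}(𝔽_p)| = p` and `(|Ẽ^{ns}(𝔽_p)|/p) · log_{ω_𝓔} P / c ≢ 0 (mod p)` (tree reading `¬ ‖·‖_p ≤ p⁻¹`,
`log_{ω_𝓔} = Castella2018.padicLogOmega` the Néron-normalised logarithm, `log_{ω_E} = log_{ω_𝓔}/c`),
then `log_{ω_𝓔} P ≠ 0`, `c ≠ 0` and `ord_p log_{ω_𝓔} P ≤ ord_p c` (`ord_p log_{ω_𝓔} P` = the tree's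
`X11b.padicLogOrd`, by `Castella2018.valuation_padicLogOmega`). Only the direction «`<` one» of
«is a unit» is used — no integrality input. [cite: KrizLi2019, Thm. 1.20 (p. 8) and Rem. 1.17 (p. 6)] -/
theorem padicLogOrd_le_padicValInt_of_krizLi (hns : KrizLi2019.nsPointCount W p = p)
    (hne : ¬ ‖((KrizLi2019.nsPointCount W p : ℤ) : ℚ_[p]) / (p : ℚ_[p]) *
        (Castella2018.padicLogOmega W p ιp P / (c : ℚ_[p]))‖ ≤ (p : ℝ)⁻¹) :
    Castella2018.padicLogOmega W p ιp P ≠ 0 ∧ c ≠ 0 ∧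
      X11b.padicLogOrd W p ιp P ≤ (padicValInt p c : ℤ) := by
  set L := Castella2018.padicLogOmega W p ιp P with hL
  have hp : p.Prime := Fact.out
  have hp0 : (p : ℚ_[p]) ≠ 0 := mod_cast hp.ne_zero
  have hone : ((KrizLi2019.nsPointCount W p : ℤ) : ℚ_[p]) / (p : ℚ_[p]) = 1 := by
    rw [hns, Int.cast_natCast, div_self hp0]
  rw [hone, one_mul] at hne
  have hL0 : L ≠ 0 := by
    intro h0; apply hne; rw [h0, zero_div, norm_zero]; positivity
  have hc0' : (c : ℚ_[p]) ≠ 0 := by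
    intro h0; apply hne; rw [h0, div_zero, norm_zero]; positivity
  have hc0 : c ≠ 0 := fun h0 => hc0' (by rw [h0, Int.cast_zero])
  refine ⟨hL0, hc0, ?_⟩
  have hx : L / (c : ℚ_[p]) ≠ 0 := div_ne_zero hL0 hc0'
  have hp_pos : (0 : ℝ) < p := mod_cast hp.pos
  have hp1 : (1 : ℝ) < p := mod_cast hp.one_lt
  -- `‖L/c‖ = p^{-v}`, `v = ord_p L − ord_p c`, and `¬ p^{-v} ≤ p^{-1}` forces `v ≤ 0`
  have hnorm := Padic.norm_eq_zpow_neg_valuation hx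
  rw [hnorm] at hne
  have hlt : (-1 : ℤ) < -(L / (c : ℚ_[p])).valuation := by
    by_contra hle
    apply hne
    calc (p : ℝ) ^ (-(L / (c : ℚ_[p])).valuation) ≤ (p : ℝ) ^ (-1 : ℤ) :=
          zpow_le_zpow_right₀ hp1.le (not_lt.mp hle)
      _ = (p : ℝ)⁻¹ := zpow_neg_one _
  -- the cell's `X11b.padicLogOrd` and the Literature reading `padicLogOrd` have the same body
  have hX : X11b.padicLogOrd W p ιp P = Literature.NumberTheory.EllipticCurves.padicLogOrd W p ιp P :=
    rfl
  have hv : (L / (c : ℚ_[p])).valuation = X11b.padicLogOrd W p ιp P - (padicValInt p c : ℤ) := by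
    rw [div_eq_mul_inv, Padic.valuation_mul hL0 (inv_ne_zero hc0'), Padic.valuation_inv,
      Padic.valuation_intCast, Castella2018.valuation_padicLogOmega hL0, hX]
    ring
  rw [hv] at hlt
  omega

end Valuation

/-! ## §2 The socket at a frame from CTL₀ and the Kriz–Li conclusion -/

section Frame

variable {p : ℕ} [Fact p.Prime] {K : Type} [Field K] [NumberField K]
  {W : WeierstrassCurve ℚ} [W.IsElliptic] [W.IsGloballyMinimal] {κ : ZpExtension K p}
  {𝔭 : HeightOneSpectrum (𝓞 K)} {γ : Field.absoluteGaloisGroup K} [Fact (κ.IsTopGenerator γ)]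
  {ιp : K →+* ℚ_[p]} {P : (W.baseChange K).toAffine.Point} {c : ℤ}

/-- **T-B6-1♯ at a frame in the Kriz–Li regime, from CTL₀ alone.** If `X_ac^∅(E_K[p^∞])` is `Λ`-torsion
with a characteristic generator of non-zero constant term (`∃ n, HasCharValuationAt … n` — CTL₀), and at
the datum `|Ẽ^{ns}(𝔽_p)| = p` and Kriz–Li's conclusion holds for the constant `c`, then the slack-`v_p(c)`
socket `AdditiveIMCLowerBDPOnTreeLeAt p κ 𝔭 γ ιp (v_p c) P` holds: `2·ord_p log P ≤ 2·v_p(c) ≤ n + 2·v_p(c)`.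
(Door-c2 g2's `additiveIMCLowerBDPOnTreeLeAt_of_control_of_padicLogOrd_le` with the control hypothesis
weakened to CTL₀ and its `hlog` discharged by §1.) [cite: KrizLi2019, Thm. 1.20 (p. 8)]
[cite: JetchevSkinnerWan2017, §7.4.1 (arXiv:1512.06894 p. 30)] -/
theorem additiveIMCLowerBDPOnTreeLeAt_of_charTorsion_of_krizLi
    (hCTL : ∃ n : ℕ, XAc.HasCharValuationAt (W.baseChange K) p κ 𝔭 ∅ γ n)
    (hns : KrizLi2019.nsPointCount W p = p)
    (hne : ¬ ‖((KrizLi2019.nsPointCount W p : ℤ) : ℚ_[p]) / (p : ℚ_[p]) *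
        (Castella2018.padicLogOmega W p ιp P / (c : ℚ_[p]))‖ ≤ (p : ℝ)⁻¹) :
    AdditiveIMCLowerBDPOnTreeLeAt p κ 𝔭 γ ιp (padicValNat p c.natAbs) P := by
  obtain ⟨n, hn⟩ := hCTL
  refine ⟨n, hn, ?_⟩
  have hle := (padicLogOrd_le_padicValInt_of_krizLi hns hne).2.2
  have hc : (padicValInt p c : ℤ) = (padicValNat p c.natAbs : ℤ) := rfl
  have h0 : (0 : ℤ) ≤ (n : ℤ) := by positivity
  omega

end Frame

/-! ## §3 The door-datum theorem from the named fact -/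

section Datum

/-- **T-B6-1♯ at every Kriz–Li datum of the door, from Kriz–Li 2019 Thm. 1.20 BY NAME and CTL₀.** For a
globally minimal `W/ℚ` and an odd prime `p` on the N10 locus (additive at `p`), a Heegner datum
`(N = N_W, K, Dt, H, ι, P)` of the socket (`K` imaginary quadratic with the Heegner hypothesis for `N` —
so `p ∣ N` splits in `K` —, `ι(P)` the Heegner point of the parametrisation datum `Dt`, constant
`c = Dt.c`), Kriz–Li's binders at `(W, p)` — a primitive Dirichlet character `ψ` of conductor `f` and the
Teichmüller character `ω` with `E[p]^{ss} ≅ 𝔽_p(ψ) ⊕ 𝔽_p(ψ⁻¹ω)` in trace form at the primes `ℓ ∤ pN`,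
(1) `ψ(p) ≠ 1`, `(ψ⁻¹ω)(p) ≠ 1`, (2) no prime of split multiplicative reduction, (3) the additive-prime
condition — and at `K` — its Kronecker character `ε_K` and (4) `B_{1,ψ₀⁻¹ε_K} · B_{1,ψ₀ω⁻¹} ≢ 0 (mod p)`
—, and an anticyclotomic frame `(κ, γ, 𝔭)` with `𝔭 ∣ p` of degree one at which CTL₀ holds: the socket
`AdditiveIMCLowerBDPOnTreeLeAt p κ 𝔭 γ (embAt K p 𝔭) (v_p Dt.c) P` — verbatim what the branch cruxes
`PotMultBranchIMC` / `GordTwoBranchIMC` assert at that datum and frame — holds, with NO main conjecture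
and NO `p`-adic `L`-function. Kriz–Li is instantiated at the embedding `embAt K p 𝔭` of the frame; the
remaining socket binders (`r_an = 1`, odd `d_K`, `p ∤ #𝓞_K^×`, `L(E^{d_K},1) ≠ 0`, `P` non-torsion,
`κ` anticyclotomic) are not needed and not taken. CONDITIONAL on the named fact (hypothesis `hKL`).
[cite: KrizLi2019, Thm. 1.20 (pp. 7–8) = Thm. 7.1 (pp. 42–43), Rem. 1.17 (p. 6)]
[cite: JetchevSkinnerWan2017, §7.4.1 (arXiv:1512.06894 p. 30)] -/
theorem additiveIMCLowerBDPOnTreeLeAt_of_thm120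
    (hKL : KrizLi2019.thm120_padicLogHeegner_unit_of_bernoulli)
    (W : WeierstrassCurve ℚ) [W.IsElliptic] [W.IsGloballyMinimal] (p : ℕ) [Fact p.Prime]
    (N : ℕ) [NeZero N] (K : Type) [Field K] [NumberField K]
    (Dt : ModularParametrizationData W N) (H : HeegnerDatum N (NumberField.discr K)) (ι : K →+* ℂ)
    (P : (W.baseChange K).toAffine.Point)
    (hloc : Additive.N10.Locus W p) (hN : W.conductorNorm ℤ = N) (hK : IsImaginaryQuadratic K)
    (hHe : SatisfiesHeegnerHypothesis N K)
    (hP : WeierstrassCurve.Affine.Point.map ι.toRatAlgHom P = heegnerPointComplex Dt H)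
    -- Kriz–Li's binders at `(W, p)`
    (f : ℕ) [NeZero f] (ψ : DirichletCharacter ℚ_[p] f) (ω : DirichletCharacter ℚ_[p] p)
    (hψ : ψ.IsPrimitive) (hω : KrizLi2019.IsTeichmullerCharacter ω)
    (hss : ∀ ℓ : ℕ, ℓ.Prime → ¬ (ℓ ∣ p * W.conductorNorm ℤ) →
      ‖((W.LFunction ℓ : ℤ) : ℚ_[p]) -
          (ψ (ℓ : ZMod f) + ψ⁻¹ (ℓ : ZMod f) * ω (ℓ : ZMod p))‖ < 1)
    (h1 : ψ (p : ZMod f) ≠ 1) (h1' : KrizLi2019.primVal (KrizLi2019.invMulOmega ψ ω) p ≠ 1)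
    (h2 : ∀ ℓ : ℕ, (hℓ : ℓ.Prime) →
      ¬ (haveI := Fact.mk hℓ; W.HasSplitMultiplicativeReductionAtPrime ℓ))
    (h3 : ∀ ℓ : ℕ, (hℓ : ℓ.Prime) → ℓ ≠ p →
      (haveI := Fact.mk hℓ;
        ¬ W.HasGoodReductionAtPrime ℓ ∧ ¬ W.HasMultiplicativeReductionAtPrime ℓ) →
      ψ (ℓ : ZMod f) ≠ 1 ∧ KrizLi2019.primVal (KrizLi2019.invMulOmega ψ ω) ℓ ≠ 1)
    -- Kriz–Li's binders at `K`
    (εK : DirichletCharacter ℚ_[p] (NumberField.discr K).natAbs)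
    (hεK : KrizLi2019.IsKroneckerCharacterOf K εK)
    (h4 : ¬ (‖KrizLi2019.bernoulliOnePrim (KrizLi2019.bernoulliCharOne ψ εK) *
        KrizLi2019.bernoulliOnePrim (KrizLi2019.bernoulliCharTwo ψ εK ω)‖ ≤ (p : ℝ)⁻¹))
    -- the frame and CTL₀ at it
    (κ : ZpExtension K p) (γ : Field.absoluteGaloisGroup K) [Fact (κ.IsTopGenerator γ)]
    (𝔭 : HeightOneSpectrum (𝓞 K)) (h𝔭 : ((p : ℕ) : 𝓞 K) ∈ 𝔭.asIdeal)
    (he : 𝔭.asIdeal.ramificationIdx (𝓞 ℚ) = 1) (hf : 𝔭.asIdeal.inertiaDeg (𝓞 ℚ) = 1)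
    (hCTL : ∃ n : ℕ, XAc.HasCharValuationAt (W.baseChange K) p κ 𝔭 ∅ γ n) :
    AdditiveIMCLowerBDPOnTreeLeAt p κ 𝔭 γ (embAt K p 𝔭 h𝔭 he hf) (padicValNat p Dt.c.natAbs) P := by
  have hp : p.Prime := Fact.out
  subst hN
  haveI : NeZero (NumberField.discr K).natAbs :=
    ⟨Int.natAbs_ne_zero.mpr (NumberField.discr_ne_zero K)⟩
  have hadd : Addv W p := hloc.2.1
  have hpN : p ∣ W.conductorNorm ℤ :=
    (W.dvd_conductorNorm_iff_not_hasGoodReductionAtPrime p).mpr hadd.1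
  have hsplit : ((Ideal.span {(p : ℤ)}).primesOver (𝓞 K)).ncard = 2 := hHe p hp hpN
  have hne := hKL p hloc.1 W f ψ ω hψ hω hss h1 h1' h2 h3 Dt K hK hHe hsplit εK hεK H ι
    (embAt K p 𝔭 h𝔭 he hf) P hP h4
  exact additiveIMCLowerBDPOnTreeLeAt_of_charTorsion_of_krizLi hCTL (nsPointCount_eq_self_of_addv hadd)
    hne

end Datum

/-! ## §4 Over all door data, with CTL₀ in the shape of door-c4 g4's by-facts theorem -/

section Door

/-- **T-B6-1♯ on the Kriz–Li locus of the door's data, class level.** IF CTL₀ holds at every frame of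
every datum of the door (hypothesis `hCTL`, VERBATIM the conclusion of door-c4 g4's
`…ControlLeMinimal.exists_hasCharValuationAt_of_pt_of_kolyvagin` from Poitou–Tate duality + Kolyvagin),
then for every pair `(W, p)` of the door's cells (`r_an = 1`, `p ≠ 2`, `ClassX3`, semistable twist),
every datum of the socket `AdditiveIMCLowerBDPInputManinAt W p`, every Kriz–Li witness
`(f, ψ, ω, (1)–(3); ε_K, (4))` and every anticyclotomic frame `(κ, γ, 𝔭)` with `𝔭 ∣ p` of degree one,
the socket's conclusion `AdditiveIMCLowerBDPOnTreeLeAt p κ 𝔭 γ (embAt K p 𝔭) (v_p Dt.c) P` holds —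
from Kriz–Li 2019 Thm. 1.20 BY NAME (`hKL`). With door-c4 g4's theorem this is «{Poitou–Tate duality,
Kolyvagin, Kriz–Li Thm. 1.20} ⟹ T-B6-1♯ at every Kriz–Li datum», on BOTH cells (M) and (G-ord, `e = 2`).
CONDITIONAL on `hKL` and `hCTL`; nothing else assumed. [cite: KrizLi2019, Thm. 1.20 (pp. 7–8)]
[cite: JetchevSkinnerWan2017, §7.4.1 (arXiv:1512.06894 p. 30)]
[cite: Castella2018, Thm. 2.3 (arXiv:1704.06608 p. 5)] -/
theorem additiveIMCLowerBDP_krizLiData_of_thm120_of_charTorsion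
    (hKL : KrizLi2019.thm120_padicLogHeegner_unit_of_bernoulli)
    (hCTL : ∀ (W : WeierstrassCurve ℚ) [W.IsElliptic] [W.IsGloballyMinimal] (p : ℕ) [Fact p.Prime],
      W.analyticRank = 1 → p ≠ 2 → ClassX3 W p → Additive.SubSemistableTwist W p →
      ∀ (N : ℕ) [NeZero N] (K : Type) [Field K] [NumberField K]
        (Dt : ModularParametrizationData W N) (H : HeegnerDatum N (NumberField.discr K)) (ι : K →+* ℂ)
        (P : (W.baseChange K).toAffine.Point),
        W.analyticRank = 1 → Additive.N10.Locus W p → W.conductorNorm ℤ = N → IsImaginaryQuadratic K →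
        Odd (NumberField.discr K) → ¬ p ∣ Units.torsionOrder K → SatisfiesHeegnerHypothesis N K →
        (W.quadraticTwist (NumberField.discr K : ℚ)).entireLFunction 1 ≠ 0 →
        WeierstrassCurve.Affine.Point.map ι.toRatAlgHom P = heegnerPointComplex Dt H →
        ¬ IsOfFinAddOrder P →
        ∀ (κ : ZpExtension K p), κ.IsAnticyclotomic →
          ∀ (γ : Field.absoluteGaloisGroup K) [Fact (κ.IsTopGenerator γ)]
            (𝔭 : HeightOneSpectrum (𝓞 K)), ((p : ℕ) : 𝓞 K) ∈ 𝔭.asIdeal →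
            𝔭.asIdeal.ramificationIdx (𝓞 ℚ) = 1 → 𝔭.asIdeal.inertiaDeg (𝓞 ℚ) = 1 →
            ∃ n : ℕ, XAc.HasCharValuationAt (W.baseChange K) p κ 𝔭 ∅ γ n) :
    ∀ (W : WeierstrassCurve ℚ) [W.IsElliptic] [W.IsGloballyMinimal] (p : ℕ) [Fact p.Prime],
      W.analyticRank = 1 → p ≠ 2 → ClassX3 W p → Additive.SubSemistableTwist W p →
      ∀ (N : ℕ) [NeZero N] (K : Type) [Field K] [NumberField K]
        (Dt : ModularParametrizationData W N) (H : HeegnerDatum N (NumberField.discr K)) (ι : K →+* ℂ)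
        (P : (W.baseChange K).toAffine.Point),
        W.analyticRank = 1 → Additive.N10.Locus W p → W.conductorNorm ℤ = N → IsImaginaryQuadratic K →
        Odd (NumberField.discr K) → ¬ p ∣ Units.torsionOrder K → SatisfiesHeegnerHypothesis N K →
        (W.quadraticTwist (NumberField.discr K : ℚ)).entireLFunction 1 ≠ 0 →
        WeierstrassCurve.Affine.Point.map ι.toRatAlgHom P = heegnerPointComplex Dt H →
        ¬ IsOfFinAddOrder P →
        -- Kriz–Li's binders at `(W, p)` and at `K`
        ∀ (f : ℕ) [NeZero f] (ψ : DirichletCharacter ℚ_[p] f) (ω : DirichletCharacter ℚ_[p] p),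
          ψ.IsPrimitive → KrizLi2019.IsTeichmullerCharacter ω →
          (∀ ℓ : ℕ, ℓ.Prime → ¬ (ℓ ∣ p * W.conductorNorm ℤ) →
            ‖((W.LFunction ℓ : ℤ) : ℚ_[p]) -
                (ψ (ℓ : ZMod f) + ψ⁻¹ (ℓ : ZMod f) * ω (ℓ : ZMod p))‖ < 1) →
          ψ (p : ZMod f) ≠ 1 → KrizLi2019.primVal (KrizLi2019.invMulOmega ψ ω) p ≠ 1 →
          (∀ ℓ : ℕ, (hℓ : ℓ.Prime) →
            ¬ (haveI := Fact.mk hℓ; W.HasSplitMultiplicativeReductionAtPrime ℓ)) →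
          (∀ ℓ : ℕ, (hℓ : ℓ.Prime) → ℓ ≠ p →
            (haveI := Fact.mk hℓ;
              ¬ W.HasGoodReductionAtPrime ℓ ∧ ¬ W.HasMultiplicativeReductionAtPrime ℓ) →
            ψ (ℓ : ZMod f) ≠ 1 ∧ KrizLi2019.primVal (KrizLi2019.invMulOmega ψ ω) ℓ ≠ 1) →
        ∀ (εK : DirichletCharacter ℚ_[p] (NumberField.discr K).natAbs),
          KrizLi2019.IsKroneckerCharacterOf K εK →
          ¬ (‖KrizLi2019.bernoulliOnePrim (KrizLi2019.bernoulliCharOne ψ εK) *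
              KrizLi2019.bernoulliOnePrim (KrizLi2019.bernoulliCharTwo ψ εK ω)‖ ≤ (p : ℝ)⁻¹) →
        ∀ (κ : ZpExtension K p), κ.IsAnticyclotomic →
          ∀ (γ : Field.absoluteGaloisGroup K) [Fact (κ.IsTopGenerator γ)]
            (𝔭 : HeightOneSpectrum (𝓞 K)) (h𝔭 : ((p : ℕ) : 𝓞 K) ∈ 𝔭.asIdeal)
            (he : 𝔭.asIdeal.ramificationIdx (𝓞 ℚ) = 1) (hf : 𝔭.asIdeal.inertiaDeg (𝓞 ℚ) = 1),
            AdditiveIMCLowerBDPOnTreeLeAt p κ 𝔭 γ (embAt K p 𝔭 h𝔭 he hf) (padicValNat p Dt.c.natAbs) P := by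
  intro W _ _ p _ hr hp2 hX hS N _ K _ _ Dt H ι P hr' hloc hN hK hodd hunit hHe hL1 hP hnt f _ ψ ω hψ hω
    hss h1 h1' h2 h3 εK hεK h4 κ hκ γ _ 𝔭 h𝔭 he hf
  exact additiveIMCLowerBDPOnTreeLeAt_of_thm120 hKL W p N K Dt H ι P hloc hN hK hHe hP f ψ ω hψ hω hss
    h1 h1' h2 h3 εK hεK h4 κ γ 𝔭 h𝔭 he hf
    (hCTL W p hr hp2 hX hS N K Dt H ι P hr' hloc hN hK hodd hunit hHe hL1 hP hnt κ hκ γ 𝔭 h𝔭 he hf)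

end Door

end Summit.BirchSwinnertonDyer.BirchSwinnertonDyer.Theorems.SchneiderFree

end
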